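import Mathlib
import Literature.AlgebraicGeometry.RelativeSpec.FiniteGroupQuotientGluedProperties
import Literature.AlgebraicGeometry.RelativeSpec.FiniteGroupQuotientGenericEtale
import Literature.AlgebraicGeometry.Resolution.ResolutionOfSingularities
import Literature.AlgebraicGeometry.Resolution.BirationalFlatteningCharts
import Literature.AlgebraicGeometry.Resolution.AlterationsResolution
import Summits.ResolutionOfSingularities.ResolutionOfSingularities.Theorems.WildQuotientsGaloisQuotientStableCover
import Summits.ResolutionOfSingularities.ResolutionOfSingularities.Theorems.WildQuotientsGaloisQuotientEtaleGlued
import HarnessLib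

/-!
# Lemmas for the quotient model `X♯/G → X₁` (crux `WildQuotients.WildQuotientResolution`, line `Sketch`)

Helpers for the stub `stub_quotientModel` of the skeleton `Sketch` for crux
stmt-ResolutionOfSingularities-15640 (route `ResolutionOfSingularities/WildQuotients`), file
`…Theorems.WildQuotientsWildQuotientResolutionStubQuotientModel`: the quotient `X♯/G` of a
`G`-equivariant proper birational model `π : X♯ → X′` of a Galois-type quotient datum
`q : X′ → X₁` is finite ÉTALE over a dense open of `X₁`. The étaleness is SGA 1, Exp. V,
Prop. 2.6 read backwards on an affine chart `W ⊆ X₁`: on rings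
`A = Γ(X₁, W) → C = Γ(O/G, ·) → B = Γ(O, ·)` (`O = (π ≫ q)⁻¹ W₁` a `G`-stable affine), `C → B`
is the inclusion of the invariants of a FREE action, faithfully flat and étale by
Chase–Harrison–Rosenberg (`etale_of_free'`), and `A → B = q♯` (up to isomorphisms) is finite
étale; hence `A → C` is étale:

* `flat_of_faithfullyFlat_of_flat`, `etale_of_etale_of_faithfullyFlat` — flatness and
  étaleness descend along a faithfully flat étale extension OF THE SOURCE (`Ω_{C/A} ⊗_C B ≅
  Ω_{B/A} = 0`; flat + unramified + finitely presented is étale, Mathlib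
  `Algebra.Etale.of_formallyUnramified_of_flat`);
* `eq_genericPoint_of_apply_eq`, `exists_open_preimage_le`, `eq_of_isIso_morphismRestrict`,
  `exists_eq_of_isIso_morphismRestrict`, `morphismRestrict_of_le`,
  `isAffineOpen_preimage_of_isIso_morphismRestrict`, `morphismRestrict_iff_of_chart` — small
  scheme-theoretic helpers (fibres of quasi-finite maps over the generic point; closed maps;
  isomorphism loci; charts);
* `augIdeal_eq_top_of_le`, `etale_quotientToBase_app'` (`etale_quotientToBase_app`: the
  freeness spelled out via `ActionOver.act`), `etale_and_finite_app_comp` — the chart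
  computation above for the tree's affine quotient `ActionOver.quotient`
  (`Literature.AlgebraicGeometry.RelativeSpec.FiniteGroupQuotient`).
-/

-- single-problem summit: the doubled namespace component `ResolutionOfSingularities` is forced
set_option linter.dupNamespace false

noncomputable section

namespace Summit.ResolutionOfSingularities.ResolutionOfSingularities.Theorems.WildQuotientResolution.QuotientModel

open CategoryTheory Limits AlgebraicGeometry TopologicalSpace
open Literature.AlgebraicGeometry.Resolution Literature.AlgebraicGeometry.RelativeSpec
open Literature.AlgebraicGeometry.Motives Literature.AlgebraicGeometry.Motives.RatFn
open scoped TensorProduct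

universe u

/-! ## Étaleness descends along a faithfully flat étale extension of the source -/

section Descent

variable {A C B : Type*} [CommRing A] [CommRing C] [CommRing B] [Algebra A C] [Algebra C B]
  [Algebra A B] [IsScalarTower A C B]

/-- **Flatness is local on the source for the flat topology**: for `A → C → B` with `B`
faithfully flat over `C` and flat over `A`, `C` is flat over `A` (tensor the sequence with `B`
over `C` and use `B ⊗_C (C ⊗_A N) = B ⊗_A N`). [folklore] -/
theorem flat_of_faithfullyFlat_of_flat [Module.FaithfullyFlat C B] [Module.Flat A B] :
    Module.Flat A C := by
  rw [Module.Flat.iff_lTensor_preserves_injective_linearMap]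
  intro N P _ _ _ _ f hf
  have h1 : Function.Injective (f.lTensor B) := Module.Flat.lTensor_preserves_injective_linearMap f hf
  have key := TensorProduct.AlgebraTensorModule.lTensor_comp_cancelBaseChange
    (R := A) (A := C) (B := C) (M := B) (N := N) (Q := P) f
  have e := congrArg (fun φ : B ⊗[C] (C ⊗[A] N) →ₗ[C] B ⊗[A] P => (φ : _ → _)) key
  simp only [LinearMap.coe_comp, LinearEquiv.coe_coe] at e
  have h2 : Function.Injective
      ((TensorProduct.AlgebraTensorModule.cancelBaseChange A C C B P) ∘
        (TensorProduct.AlgebraTensorModule.lTensor C B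
          (TensorProduct.AlgebraTensorModule.lTensor C C f))) := by
    rw [← e]
    exact h1.comp (TensorProduct.AlgebraTensorModule.cancelBaseChange A C C B N).injective
  have h3 : Function.Injective
      ((TensorProduct.AlgebraTensorModule.lTensor C C f).lTensor B) :=
    Function.Injective.of_comp h2
  exact (Module.FaithfullyFlat.lTensor_injective_iff_injective C B _).mp h3

/-- **Étale descent along a faithfully flat étale map of the source**: for `A → C → B` with
`C → B` étale and faithfully flat, `A → B` étale and `C` finitely presented over `A`, the map
`A → C` is étale: flat by `flat_of_faithfullyFlat_of_flat`, unramified because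
`B ⊗_C Ω_{C/A} ≅ Ω_{B/A} = 0`, and flat + unramified + finitely presented is étale.
[folklore; cf. SGA1, Exp. I, Cor. 4.8 and Exp. IX] -/
theorem etale_of_etale_of_faithfullyFlat [Algebra.Etale C B] [Module.FaithfullyFlat C B]
    [Algebra.Etale A B] [Algebra.FinitePresentation A C] : Algebra.Etale A C := by
  haveI : Module.Flat A C := flat_of_faithfullyFlat_of_flat (B := B)
  haveI : Algebra.FormallyUnramified A C := by
    refine ⟨?_⟩
    have e := KaehlerDifferential.tensorKaehlerEquivOfFormallyEtale A C B
    haveI : Subsingleton (B ⊗[C] Ω[C⁄A]) := e.toEquiv.subsingleton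
    exact Module.FaithfullyFlat.lTensor_reflects_triviality C B (Ω[C⁄A])
  exact Algebra.Etale.of_formallyUnramified_of_flat

end Descent

/-! ## Small scheme-theoretic helpers -/

section Helpers

/-- Over the generic point of the target, a quasi-finite dominant morphism of integral schemes
has only the generic point of the source (the fibre is discrete and the generic point
specialises to each of its points). [folklore] -/
theorem eq_genericPoint_of_apply_eq {X Y : Scheme.{u}} [IsIntegral X] [IsIntegral Y] (f : X ⟶ Y)
    [LocallyQuasiFinite f] [IsDominant f] {x : X} (hx : f x = genericPoint Y) :
    x = genericPoint X :=
  ((f.isDiscrete_preimage_singleton (genericPoint Y)).eq_of_specializes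
    (genericPoint_specializes x) (RatFn.genericPoint_eq_of_isDominant f) hx).symm

/-- For a closed morphism `r` and an open `Ω` of the source containing the whole fibre over the
generic point of the (integral) target, some open neighbourhood `W` of that generic point has
`r⁻¹(W) ⊆ Ω` (namely the complement of `r(Ωᶜ)`). [folklore] -/
theorem exists_open_preimage_le {X Y : Scheme.{u}} [IsIntegral X] (r : Y ⟶ X)
    (hr : IsClosedMap r) (Ω : Y.Opens) (hfib : ∀ y : Y, r y = genericPoint X → y ∈ Ω) :
    ∃ W : X.Opens, genericPoint X ∈ W ∧ r ⁻¹ᵁ W ≤ Ω := by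
  refine ⟨⟨(r '' ((Ω : Set Y)ᶜ))ᶜ, (hr _ Ω.2.isClosed_compl).isOpen_compl⟩, ?_, ?_⟩
  · rintro ⟨y, hy, e⟩
    exact hy (hfib y e)
  · intro y hy
    by_contra h
    exact hy ⟨y, h, rfl⟩

/-- If `f` restricts to an isomorphism over `V` then `f` is injective on `f⁻¹(V)`. [folklore] -/
theorem eq_of_isIso_morphismRestrict {X Y : Scheme.{u}} (f : X ⟶ Y) (V : Y.Opens)
    [IsIso (f ∣_ V)] {x₁ x₂ : X} (h₁ : x₁ ∈ f ⁻¹ᵁ V) (h₂ : x₂ ∈ f ⁻¹ᵁ V) (e : f x₁ = f x₂) :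
    x₁ = x₂ := by
  have key : (f ∣_ V) ⟨x₁, h₁⟩ = (f ∣_ V) ⟨x₂, h₂⟩ := by
    apply Subtype.ext
    rw [morphismRestrict_base_coe, morphismRestrict_base_coe]
    exact e
  exact congrArg Subtype.val ((f ∣_ V).homeomorph.injective key)

/-- If `f` restricts to an isomorphism over `V` then every point of `V` is the image of a point
of `f⁻¹(V)`. [folklore] -/
theorem exists_eq_of_isIso_morphismRestrict {X Y : Scheme.{u}} (f : X ⟶ Y) (V : Y.Opens)
    [IsIso (f ∣_ V)] {y : Y} (hy : y ∈ V) : ∃ x : X, x ∈ f ⁻¹ᵁ V ∧ f x = y := by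
  obtain ⟨x, hx⟩ := (f ∣_ V).homeomorph.surjective ⟨y, hy⟩
  refine ⟨x.1, x.2, ?_⟩
  have := congrArg Subtype.val hx
  rwa [Scheme.Hom.homeomorph_apply, morphismRestrict_base_coe] at this

/-- The image under `V ↪ Y` of the preimage of `A ≤ V` is `A`. [folklore] -/
theorem ι_image_preimage_eq {Y : Scheme.{u}} {V A : Y.Opens} (hA : A ≤ V) :
    V.ι ''ᵁ (V.ι ⁻¹ᵁ A) = A := by
  rw [Scheme.Hom.image_preimage_eq_opensRange_inf, Scheme.Opens.opensRange_ι]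
  exact inf_eq_right.mpr hA

/-- A property local on the target passes from `f ∣_ V'` to `f ∣_ V` for `V ≤ V'`. [folklore] -/
theorem morphismRestrict_of_le (P : MorphismProperty Scheme.{u}) [IsZariskiLocalAtTarget P]
    {X Y : Scheme.{u}} (f : X ⟶ Y) {V V' : Y.Opens} (hle : V ≤ V') (h : P (f ∣_ V')) :
    P (f ∣_ V) := by
  have h1 : P (f ∣_ V' ∣_ (V'.ι ⁻¹ᵁ V)) := IsZariskiLocalAtTarget.restrict h _
  have h2 : P (f ∣_ (V'.ι ''ᵁ (V'.ι ⁻¹ᵁ V))) :=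
    (P.arrow_mk_iso_iff (morphismRestrictRestrict f V' (V'.ι ⁻¹ᵁ V))).mp h1
  exact (P.arrow_mk_iso_iff (morphismRestrictEq f (ι_image_preimage_eq hle))).mp h2

/-- The preimage under `f` of an affine open `A ≤ V` is affine when `f` restricts to an
isomorphism over `V`. [folklore] -/
theorem isAffineOpen_preimage_of_isIso_morphismRestrict {X Y : Scheme.{u}} (f : X ⟶ Y)
    (V : Y.Opens) [IsIso (f ∣_ V)] {A : Y.Opens} (hA : IsAffineOpen A) (hAV : A ≤ V) :
    IsAffineOpen (f ⁻¹ᵁ A) := by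
  have h1 : IsAffineOpen (V.ι ⁻¹ᵁ A) := by
    rw [← V.ι.isAffineOpen_iff_of_isOpenImmersion, ι_image_preimage_eq hAV]
    exact hA
  have h2 : IsAffineOpen ((f ∣_ V) ⁻¹ᵁ (V.ι ⁻¹ᵁ A)) := h1.preimage_of_isIso (f ∣_ V)
  have h3 := h2.image_of_isOpenImmersion (f ⁻¹ᵁ V).ι
  rwa [image_morphismRestrict_preimage, ι_image_preimage_eq hAV] at h3

/-- **Transfer along a chart**: for an open immersion `j : Q → Y` and `r : Y → X` with
`r⁻¹(W) ⊆ j(Q)`, a property respecting isomorphisms holds for `r ∣_ W` iff it holds for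
`(j ≫ r) ∣_ W` (the two differ by the isomorphism `j ∣_ {r⁻¹ W}`). [folklore] -/
theorem morphismRestrict_iff_of_chart (P : MorphismProperty Scheme.{u}) [P.RespectsIso]
    {Q Y X : Scheme.{u}} (j : Q ⟶ Y) [IsOpenImmersion j] (r : Y ⟶ X) (W : X.Opens)
    (hW : r ⁻¹ᵁ W ≤ j.opensRange) : P ((j ≫ r) ∣_ W) ↔ P (r ∣_ W) := by
  rw [morphismRestrict_comp]
  haveI : IsIso (j ∣_ r ⁻¹ᵁ W) := by
    rw [isIso_iff_isOpenImmersion_and_surjective]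
    refine ⟨inferInstance, ⟨fun y => ?_⟩⟩
    obtain ⟨z, hz⟩ := hW y.2
    refine ⟨⟨z, show j z ∈ r ⁻¹ᵁ W by rw [hz]; exact y.2⟩, Subtype.ext ?_⟩
    rw [morphismRestrict_base_coe]
    exact hz
  exact P.cancel_left_of_respectsIso (j ∣_ r ⁻¹ᵁ W) (r ∣_ W)

end Helpers

/-! ## The chart `O/G → X₁`: freeness and étaleness at the level of rings -/

section Chart

/-- Freeness of the action on sections (the augmentation ideals `(g • b - b : b)` are the unit
ideal) passes to smaller opens of the quotient. [folklore] -/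
theorem augIdeal_eq_top_of_le {O Q : Scheme.{u}} {p : O ⟶ Q} {G : Type*} [Group G]
    (ρ' : ActionOver p G) {Ω W' : Q.Opens} (hle : W' ≤ Ω) {g : G}
    (h : letI := ρ'.mulSemiringAction Ω
      Ideal.span (Set.range fun b : Γ(O, p ⁻¹ᵁ Ω) => g • b - b) = ⊤) :
    letI := ρ'.mulSemiringAction W'
    Ideal.span (Set.range fun b : Γ(O, p ⁻¹ᵁ W') => g • b - b) = ⊤ := by
  letI := ρ'.mulSemiringAction Ω
  letI := ρ'.mulSemiringAction W'
  let res : Γ(O, p ⁻¹ᵁ Ω) →+* Γ(O, p ⁻¹ᵁ W') :=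
    (O.presheaf.map (homOfLE (p.preimage_mono hle)).op).hom
  have hmap : Ideal.map res (Ideal.span (Set.range fun b : Γ(O, p ⁻¹ᵁ Ω) => g • b - b)) ≤
      Ideal.span (Set.range fun b : Γ(O, p ⁻¹ᵁ W') => g • b - b) := by
    rw [Ideal.map_span]
    apply Ideal.span_mono
    rintro _ ⟨_, ⟨b, rfl⟩, rfl⟩
    refine ⟨res b, ?_⟩
    change g • res b - res b = res (g • b - b)
    rw [map_sub]
    congr 1
    exact (ρ'.map_act hle g b).symm
  rw [h, Ideal.map_top] at hmap
  exact top_le_iff.mp hmap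

/-- **The structure map `O/G → X₁` of an affine quotient is étale over an affine `W ⊆ X₁` over
which `O → X₁` is finite étale and the action on `O` is free** (SGA 1, V, Prop. 2.6 read
backwards): on rings `Γ(X₁, W) → Γ(O/G, W') → Γ(O, W'')` the second map is the inclusion of the
invariants, faithfully flat and étale by Chase–Harrison–Rosenberg (`etale_of_free'`), the
composite is `(O → X₁)♯`, étale and finite, so `Γ(O/G, W')` is finite over the noetherian
`Γ(X₁, W)` and étale over it by `etale_of_etale_of_faithfullyFlat`. [cite: SGA1, Exp. V, Prop. 2.6] -/
theorem etale_quotientToBase_app' {O X₁ : Scheme.{u}} {s : O ⟶ X₁} {G : Type u} [Group G]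
    [Finite G] (ρO : ActionOver s G) [IsAffineHom s] [IsLocallyNoetherian X₁] (W : X₁.Opens)
    (hW : IsAffineOpen W) (hs : (s.app W).hom.Etale) (hsfin : (s.app W).hom.Finite)
    (hfree :
      letI := (ActionOver.mk ρO.aut ρO.isGeometricQuotient_toQuotient.comp_eq).mulSemiringAction
        (ρO.quotientToBase ⁻¹ᵁ W);
      ∀ g : G, g ≠ 1 → Ideal.span (Set.range fun b :
        Γ(O, ρO.toQuotient ⁻¹ᵁ (ρO.quotientToBase ⁻¹ᵁ W)) => g • b - b) = ⊤) :
    (ρO.quotientToBase.app W).hom.Etale := by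
  classical
  have hgeo : ρO.IsGeometricQuotient ρO.toQuotient := ρO.isGeometricQuotient_toQuotient
  letI := (ActionOver.mk ρO.aut hgeo.comp_eq).mulSemiringAction (ρO.quotientToBase ⁻¹ᵁ W)
  letI algCB : Algebra Γ(ρO.quotient, ρO.quotientToBase ⁻¹ᵁ W)
      Γ(O, ρO.toQuotient ⁻¹ᵁ (ρO.quotientToBase ⁻¹ᵁ W)) :=
    (ρO.toQuotient.app (ρO.quotientToBase ⁻¹ᵁ W)).hom.toAlgebra
  let _ : Fintype G := Fintype.ofFinite G
  haveI := isInvariant_app ρO hgeo (ρO.quotientToBase ⁻¹ᵁ W)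
  haveI := faithfulSMul_app ρO hgeo (ρO.quotientToBase ⁻¹ᵁ W)
  haveI := smulCommClass_app ρO hgeo.comp_eq (ρO.quotientToBase ⁻¹ᵁ W)
  haveI : Module.Flat Γ(ρO.quotient, ρO.quotientToBase ⁻¹ᵁ W)
      Γ(O, ρO.toQuotient ⁻¹ᵁ (ρO.quotientToBase ⁻¹ᵁ W)) :=
    Literature.RingTheory.GaloisAlgebras.flat_of_free _ G hfree
  haveI : Algebra.IsIntegral Γ(ρO.quotient, ρO.quotientToBase ⁻¹ᵁ W)
      Γ(O, ρO.toQuotient ⁻¹ᵁ (ρO.quotientToBase ⁻¹ᵁ W)) :=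
    Algebra.IsInvariant.isIntegral _ _ G
  haveI : Module.FaithfullyFlat Γ(ρO.quotient, ρO.quotientToBase ⁻¹ᵁ W)
      Γ(O, ρO.toQuotient ⁻¹ᵁ (ρO.quotientToBase ⁻¹ᵁ W)) :=
    Module.FaithfullyFlat.of_comap_surjective (Algebra.IsIntegral.comap_surjective _ _)
  haveI : Algebra.Etale Γ(ρO.quotient, ρO.quotientToBase ⁻¹ᵁ W)
      Γ(O, ρO.toQuotient ⁻¹ᵁ (ρO.quotientToBase ⁻¹ᵁ W)) := etale_of_free' _ G hfree
  -- the `A`-algebra structures, `A = Γ(X₁, W)`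
  letI algAC : Algebra Γ(X₁, W) Γ(ρO.quotient, ρO.quotientToBase ⁻¹ᵁ W) :=
    (ρO.quotientToBase.app W).hom.toAlgebra
  letI algAB : Algebra Γ(X₁, W) Γ(O, ρO.toQuotient ⁻¹ᵁ (ρO.quotientToBase ⁻¹ᵁ W)) :=
    ((ρO.toQuotient.app (ρO.quotientToBase ⁻¹ᵁ W)).hom.comp (ρO.quotientToBase.app W).hom).toAlgebra
  haveI : IsScalarTower Γ(X₁, W) Γ(ρO.quotient, ρO.quotientToBase ⁻¹ᵁ W)
      Γ(O, ρO.toQuotient ⁻¹ᵁ (ρO.quotientToBase ⁻¹ᵁ W)) :=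
    IsScalarTower.of_algebraMap_eq fun _ => rfl
  -- `A → B` is `s♯` up to an isomorphism: étale and finite
  have e := Scheme.Hom.congr_app ρO.toQuotient_quotientToBase W
  have hABet : (algebraMap Γ(X₁, W) Γ(O, ρO.toQuotient ⁻¹ᵁ (ρO.quotientToBase ⁻¹ᵁ W))).Etale := by
    change (((ρO.toQuotient ≫ ρO.quotientToBase).app W).hom).Etale
    rw [e]
    exact (RingHom.Etale.respectsIso.cancel_right_isIso _ _).mpr hs
  have hABfin : (algebraMap Γ(X₁, W) Γ(O, ρO.toQuotient ⁻¹ᵁ (ρO.quotientToBase ⁻¹ᵁ W))).Finite := by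
    change (((ρO.toQuotient ≫ ρO.quotientToBase).app W).hom).Finite
    rw [e]
    exact (RingHom.finite_respectsIso.cancel_right_isIso _ _).mpr hsfin
  haveI : Algebra.Etale Γ(X₁, W) Γ(O, ρO.toQuotient ⁻¹ᵁ (ρO.quotientToBase ⁻¹ᵁ W)) :=
    RingHom.etale_algebraMap.mp hABet
  haveI : Module.Finite Γ(X₁, W) Γ(O, ρO.toQuotient ⁻¹ᵁ (ρO.quotientToBase ⁻¹ᵁ W)) :=
    RingHom.finite_algebraMap.mp hABfin
  -- `C` is finite over the noetherian `A` (a submodule of `B`), hence finitely presented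
  haveI : IsNoetherianRing Γ(X₁, W) := IsLocallyNoetherian.component_noetherian ⟨W, hW⟩
  haveI : Module.Finite Γ(X₁, W) Γ(ρO.quotient, ρO.quotientToBase ⁻¹ᵁ W) :=
    Module.Finite.of_injective
      (IsScalarTower.toAlgHom Γ(X₁, W) Γ(ρO.quotient, ρO.quotientToBase ⁻¹ᵁ W)
        Γ(O, ρO.toQuotient ⁻¹ᵁ (ρO.quotientToBase ⁻¹ᵁ W))).toLinearMap
      (hgeo.app_injective (ρO.quotientToBase ⁻¹ᵁ W))
  haveI : Algebra.FinitePresentation Γ(X₁, W) Γ(ρO.quotient, ρO.quotientToBase ⁻¹ᵁ W) :=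
    (Algebra.FinitePresentation.of_finiteType).mp inferInstance
  haveI : Algebra.Etale Γ(X₁, W) Γ(ρO.quotient, ρO.quotientToBase ⁻¹ᵁ W) :=
    etale_of_etale_of_faithfullyFlat (B := Γ(O, ρO.toQuotient ⁻¹ᵁ (ρO.quotientToBase ⁻¹ᵁ W)))
  exact RingHom.etale_algebraMap.mpr this

/-- **The structure map `O/G → X₁` of an affine quotient by a finite group is étale over an
affine `W ⊆ X₁` over which `O → X₁` is finite étale and the action on `Γ(O, ·)` is free**
(the augmentation ideals `(g • b - b : b)`, `g ≠ 1`, are the unit ideal; the action on sections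
is `ActionOver.act`): SGA 1, V, Prop. 2.6 read backwards — `etale_quotientToBase_app'` with the
freeness hypothesis spelled out. [cite: SGA1, Exp. V, Prop. 2.6] -/
theorem etale_quotientToBase_app {O X₁ : Scheme.{0}} {s : O ⟶ X₁} {G : Type} [Group G]
    [Finite G] (ρO : ActionOver s G) [IsAffineHom s] [IsLocallyNoetherian X₁] (W : X₁.Opens)
    (hW : IsAffineOpen W) (hs : (s.app W).hom.Etale) (hsfin : (s.app W).hom.Finite)
    (hfree : ∀ g : G, g ≠ 1 → Ideal.span (Set.range fun b :
      Γ(O, ρO.toQuotient ⁻¹ᵁ (ρO.quotientToBase ⁻¹ᵁ W)) =>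
        (ActionOver.mk ρO.aut ρO.isGeometricQuotient_toQuotient.comp_eq).act g
          (ρO.quotientToBase ⁻¹ᵁ W) b - b) = ⊤) :
    (ρO.quotientToBase.app W).hom.Etale :=
  etale_quotientToBase_app' ρO W hW hs hsfin hfree

/-- **`(O ↪ X♯ → X′ → X₁)♯` on an affine `W` is étale and finite** when `q : X′ → X₁` is finite
and étale over `W`, `π : X♯ → X′` is an isomorphism over `V ⊇ q⁻¹(W)` and `O ⊇ π⁻¹(q⁻¹(W))`:
it is `q♯` followed by two isomorphisms of rings of sections. [folklore] -/
theorem etale_and_finite_app_comp {Xs X' X₁ : Scheme.{u}} (π : Xs ⟶ X') (q : X' ⟶ X₁)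
    [IsFinite q] (V : X'.Opens) [IsIso (π ∣_ V)] (O : Xs.Opens) (W : X₁.Opens)
    (hW : IsAffineOpen W) (hWV : q ⁻¹ᵁ W ≤ V) (hWO : (π ≫ q) ⁻¹ᵁ W ≤ O)
    (het : Etale (q ∣_ W)) :
    ((O.ι ≫ π ≫ q).app W).hom.Etale ∧ ((O.ι ≫ π ≫ q).app W).hom.Finite := by
  haveI : IsIso (π.app (q ⁻¹ᵁ W)) := isIso_app_of_isIso_morphismRestrict_of_le π V _ hWV
  haveI : IsIso (O.ι.app (π ⁻¹ᵁ (q ⁻¹ᵁ W))) :=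
    O.ι.isIso_app _ (by rw [Scheme.Opens.opensRange_ι]; exact hWO)
  have hq : (q.app W).hom.Etale := by
    haveI : IsAffine W := hW
    haveI : IsAffine (q ⁻¹ᵁ W) := hW.preimage q
    have h := (HasRingHomProperty.iff_of_isAffine (P := @Etale)).mp het
    rw [morphismRestrict_appTop] at h
    have h' := (RingHom.Etale.respectsIso.cancel_right_isIso _ _).mp h
    rwa [W.ι_image_top] at h'
  have hqfin : (q.app W).hom.Finite := IsFinite.finite_app q W hW
  rw [Scheme.Hom.comp_app, Scheme.Hom.comp_app]
  exact ⟨(RingHom.Etale.respectsIso.cancel_right_isIso (q.app W ≫ π.app _) (O.ι.app _)).mpr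
      ((RingHom.Etale.respectsIso.cancel_right_isIso (q.app W) (π.app _)).mpr hq),
    (RingHom.finite_respectsIso.cancel_right_isIso (q.app W ≫ π.app _) (O.ι.app _)).mpr
      ((RingHom.finite_respectsIso.cancel_right_isIso (q.app W) (π.app _)).mpr hqfin)⟩

end Chart

end Summit.ResolutionOfSingularities.ResolutionOfSingularities.Theorems.WildQuotientResolution.QuotientModel

end
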